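import Mathlib
import HarnessLib
import Summits.PneNP.PneNP.Theorems.AeaCutRectanglesTransversalEngine
import Summits.PneNP.PneNP.Theorems.AeaCutRectanglesDutyRectangles

/-!
# Crux `FoolingMeasure` (stmt-PneNP-19727) — p4 g9: the BIVALENCE (MEDIAN) WALL of the unit engine

Companion to `Cruxes/FoolingMeasure/BarrierNotesP4g9.md`.  Continues `UnitFloor.lean` (g5), `WitnessRankWall.lean` (g6),
`ClosureAvalanche.lean` (g7), `UnitCriticality.lean` (g8).  Everything concerns the HYPOTHESIS of the unit engine
`AeaCutRectanglesFixedCutFooling.foolingMeasure_of_spreadSystem` (frame `W`, units `π i` of two pairs, D1 = cover over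
transversals, D2 = exactness witnesses, SPREAD over near-balanced cuts) — never `FoolingMeasure` itself.
HONEST FRAMING: elementary finite combinatorics and linear algebra over `ZMod 2`; FRONTIER restricted-model material
(AEA cut rectangles vs NON-3-COL); nothing here bears on P versus NP.

## The wall (answers Q11 of BarrierNotesP4g8 §9: "all-binary / typed frames — is `m = O(n)` there?"  YES, `m ≤ 2n + 2`.)

Call a family of D2 witnesses `c j` (`j ∈ S₀`) BIVALENT if at every vertex at most two colours occur among them
(`Bivalent`).  THEOREM `card_le_of_bivalent_witnesses`: in a D1 ∧ D2 unit system every bivalent witness family has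
`|S₀| ≤ 2n + 2`.  Consequences:
* `units_le_of_typed` / `not_spread_of_typed`: a TYPED frame (a palette triangle in `W`, every other vertex `W`-adjacent
  to a palette vertex — i.e. the frame is a 2-LIST-colouring instance, the bijunctive / 2-SAT fragment) has ALL its
  (palette-normalised) witnesses bivalent, hence `m ≤ 2n + 2` units, hence is never SPREAD (`n ≥ 64`).  This closes the
  whole design space of "binary-constraint / typed-register / 2-CNF frames, computed transports through typed wires"
  (BarrierNotesP4g8 (B4)): superlinearity REQUIRES vertices at which the witnesses use all three colours.
* `rainbow_nonempty` / `units_le_rainbow_patterns` / `units_le_pow_rainbow` (§6, NO typedness assumed): for EVERY D1 ∧ D2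
  system and EVERY family of D2 witnesses `c`, with `rainbow c` = the vertices receiving all three colours from the family,
  `m ≤ (2n + 2) · #{patterns of the witnesses on rainbow c} ≤ (2n + 2) · 3 ^ |rainbow c|`; so `m > 2n + 2` forces a rainbow
  vertex in every witness family, and `m` units force `≥ m / (2n + 2)` distinct witness colourings of the rainbow set
  (Toft `𝒯_L` with its explicit witnesses `col`: the rainbow set is exactly the two ODD CYCLES `A ∪ D` — `2L = n/5` vertices
  carrying all `L² = m` patterns (position of the special colour on each cycle) — while the registers `b, b', c, c'` are bivalent).
* `units_le_patterns` (§5): the same budget relative to any set `U` outside which the frame is typed.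
* `units_le_of_swap_witnesses` (§7): the Kempe-star / swap wall of g8 §2 is the special case "bivalent because every witness
  is a swap of one base colouring on one colour pair" (constant `2n + 2` instead of `n + 1`), with no base colouring, no
  Kempe-closure and no swap structure assumed here.

## Proof (three moves, all kernel-checked below)

(1) MAJORITY IS A POLYMORPHISM OF BIVALENT FAMILIES (`maj_not_mem_killSet`): for `S ⊆ S₀` of ODD size the vertexwise
    strict-majority colouring `maj c S` is proper on `W`; so D1 (`exists_mono_unit`) gives a unit `w` whose pair is
    monochromatic under `maj c S`; two pigeonholes (`exists_source`) give `w ∈ S`, the majority colour is `c w`'s own mono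
    colour `q`, and every other `j ∈ S` is REGULAR on `w`'s pair `{u, v}`: exactly one of `c j u = q`, `c j v = q`
    (`phi c u v w j = 1` over `ZMod 2`; the excluded case "neither" is the ESCAPE that typed designs would need).
(2) SOURCE SEQUENCE (`exists_chain`): peeling sources off odd subsets gives `y₁, …, y_h`, `h ≥ ⌈|S₀|/2⌉`, with
    `phi (y k) (y l) = 1` for `k < l` and `= 0` for `k = l` (a unitriangular pattern).
(3) AFFINE RANK (`triangular_parity_le`): bivalence makes `j ↦ phi w j` an AFFINE functional over `ZMod 2` of the bit
    vector `x ↦ [c j x = a x]`; the vectors `X (y l) + X (y h)` (`l < h`) are then linearly independent in `(Fin n → ZMod 2)`,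
    so `h ≤ n + 1` and `|S₀| ≤ 2n + 2`.
ESCAPING HYPOTHESIS (named): TRIVALENT vertices — the only place where the majority of three witnesses is undefined
(3-colouring has no majority polymorphism; 2-list colouring does: Schaefer / Erdős–Rubin–Taylor).
-/

set_option linter.dupNamespace false

namespace Summit.PneNP.PneNP.Cruxes.FoolingMeasure.P4g9

open Finset
open Summit.PneNP.PneNP.Theorems.AeaCutRectanglesTransversalEngine
open Summit.PneNP.PneNP.Theorems.AeaCutRectanglesDutyRectangles

/-- A D1 ∧ D2 UNIT SYSTEM on `Fin n` with `m` units: verbatim the first three conjuncts of the hypothesis of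
`foolingMeasure_of_spreadSystem` (and verbatim `P4g4…P4g8.IsUnitSystem`; crux workfiles are not importable). -/
def IsUnitSystem (n m : ℕ) (W : Finset (Sym2 (Fin n))) (π : Fin m → Finset (Sym2 (Fin n))) : Prop :=
  (∀ i, (π i).card = 2) ∧
  (∀ t : Fin m → Sym2 (Fin n), (∀ i, t i ∈ π i) →
    (∀ e ∈ tg W t, ¬ e.IsDiag) ∧ ¬ (SimpleGraph.fromEdgeSet (↑(tg W t) : Set (Sym2 (Fin n)))).Colorable 3) ∧
  (∀ i, (SimpleGraph.fromEdgeSet (↑(gammaMinus W π i) : Set (Sym2 (Fin n)))).Colorable 3)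

variable {n m : ℕ} {W : Finset (Sym2 (Fin n))} {π : Fin m → Finset (Sym2 (Fin n))}

/-! ## §0  Anatomy (re-proved verbatim from g5–g8) and the colouring form of D1 -/

theorem unit_nonempty (hsys : IsUnitSystem n m W π) (i : Fin m) : (π i).Nonempty :=
  card_pos.1 (by rw [hsys.1 i]; norm_num)

/-- Every unit pair is loopless. -/
theorem not_isDiag_of_mem (hsys : IsUnitSystem n m W π) {i : Fin m} {e : Sym2 (Fin n)} (he : e ∈ π i) :
    ¬ e.IsDiag := by
  classical
  let t : Fin m → Sym2 (Fin n) := fun j => if j = i then e else (unit_nonempty hsys j).choose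
  have ht : ∀ j, t j ∈ π j := by
    intro j
    by_cases hj : j = i
    · subst hj; simp [t, he]
    · simp [t, hj, (unit_nonempty hsys j).choose_spec]
  have h := (hsys.2.1 t ht).1 (t i) (mem_tg.2 (Or.inr ⟨i, rfl⟩))
  simpa [t] using h

/-- A D2 witness of unit `j` is bichromatic on every pair of every other unit. -/
theorem witness_bichromatic (hsys : IsUnitSystem n m W π) {i j : Fin m} (hij : i ≠ j) {c : Fin n → Fin 3}
    (hc : c ∉ killSet (gammaMinus W π j)) {a b : Fin n} (hab : s(a, b) ∈ π i) : c a ≠ c b := by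
  intro h
  exact hc ⟨s(a, b), mem_gammaMinus.2 (Or.inr ⟨i, hij, hab⟩), not_isDiag_of_mem hsys hab,
    (map_mk_isDiag_iff c a b).2 h⟩

/-- D2 witnesses exist: one proper colouring of `Γ − πᵢ` per unit. -/
theorem exists_witnesses (hsys : IsUnitSystem n m W π) :
    ∃ c : Fin m → Fin n → Fin 3, ∀ i, c i ∉ killSet (gammaMinus W π i) := by
  have h : ∀ i, ∃ c : Fin n → Fin 3, c ∉ killSet (gammaMinus W π i) :=
    fun i => (colorable_iff_exists_not_mem_killSet _).1 (hsys.2.2 i)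
  choose c hc using h
  exact ⟨c, hc⟩

/-- A choice of ONE pair `s(u i, v i)` in every unit. -/
theorem exists_pair_fun (hsys : IsUnitSystem n m W π) : ∃ u v : Fin m → Fin n, ∀ i, s(u i, v i) ∈ π i := by
  have h : ∀ i, ∃ ab : Fin n × Fin n, s(ab.1, ab.2) ∈ π i := by
    intro i
    obtain ⟨e, he⟩ := unit_nonempty hsys i
    revert he
    induction e using Sym2.ind with
    | h a b => exact fun he => ⟨(a, b), he⟩
  choose ab hab using h
  exact ⟨fun i => (ab i).1, fun i => (ab i).2, hab⟩

/-- The frame lies inside every `Γ − πᵢ`. -/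
theorem subset_gammaMinus (i : Fin m) : W ⊆ gammaMinus W π i :=
  fun _ he => mem_gammaMinus.2 (Or.inl he)

/-- **D1 in colouring form.**  Every proper colouring of the frame makes the chosen pair of SOME unit monochromatic
(otherwise the transversal of the chosen pairs would be properly coloured). -/
theorem exists_mono_unit (hsys : IsUnitSystem n m W π) {u v : Fin m → Fin n} (huv : ∀ i, s(u i, v i) ∈ π i)
    {c : Fin n → Fin 3} (hc : c ∉ killSet W) : ∃ w, c (u w) = c (v w) := by
  by_contra hne
  push Not at hne
  obtain ⟨-, hnc⟩ := hsys.2.1 (fun i => s(u i, v i)) huv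
  obtain ⟨e, he, hd, hm⟩ := (not_colorable_iff_forall_mem_killSet _).1 hnc c
  rcases mem_tg.1 he with hW | ⟨j, rfl⟩
  · exact hc ⟨e, hW, hd, hm⟩
  · exact hne j ((map_mk_isDiag_iff c _ _).1 hm)

/-! ## §1  Majority is a polymorphism of bivalent families -/

/-- `c` is BIVALENT on the index set `S`: at every vertex at most two colours occur among the `c j`, `j ∈ S`. -/
def Bivalent (c : Fin m → Fin n → Fin 3) (S : Finset (Fin m)) : Prop :=
  ∀ x : Fin n, ∃ a b : Fin 3, ∀ j ∈ S, c j x = a ∨ c j x = b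

theorem Bivalent.mono {c : Fin m → Fin n → Fin 3} {S T : Finset (Fin m)} (h : Bivalent c T) (hST : S ⊆ T) :
    Bivalent c S := by
  intro x
  obtain ⟨a, b, hab⟩ := h x
  exact ⟨a, b, fun j hj => hab j (hST hj)⟩

/-- The vertexwise MAJORITY colouring of the family over `S` (the colour with a strict majority; default `0`). -/
def maj (c : Fin m → Fin n → Fin 3) (S : Finset (Fin m)) (x : Fin n) : Fin 3 :=
  if S.card < 2 * (S.filter fun j => c j x = 1).card then 1
  else if S.card < 2 * (S.filter fun j => c j x = 2).card then 2 else 0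

theorem fin3_cases : ∀ q : Fin 3, q = 0 ∨ q = 1 ∨ q = 2 := by decide

/-- Over an ODD bivalent family some colour has a strict majority at `x`. -/
theorem exists_majority {c : Fin m → Fin n → Fin 3} {S : Finset (Fin m)} {x : Fin n}
    (hbi : ∃ a b : Fin 3, ∀ j ∈ S, c j x = a ∨ c j x = b) (hodd : Odd S.card) :
    ∃ q : Fin 3, S.card < 2 * (S.filter fun j => c j x = q).card := by
  obtain ⟨a, b, hab⟩ := hbi
  by_contra hcon
  push Not at hcon
  have ha := hcon a
  have hb := hcon b
  have hcover : S.card ≤ (S.filter fun j => c j x = a).card + (S.filter fun j => c j x = b).card := by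
    calc S.card ≤ ((S.filter fun j => c j x = a) ∪ (S.filter fun j => c j x = b)).card := by
          refine card_le_card fun j hj => ?_
          rcases hab j hj with h | h
          · exact mem_union.2 (Or.inl (mem_filter.2 ⟨hj, h⟩))
          · exact mem_union.2 (Or.inr (mem_filter.2 ⟨hj, h⟩))
      _ ≤ _ := card_union_le _ _
  obtain ⟨r, hr⟩ := hodd
  omega

/-- The majority colour has a strict majority (odd bivalent family). -/
theorem maj_majority {c : Fin m → Fin n → Fin 3} {S : Finset (Fin m)} {x : Fin n}
    (hbi : ∃ a b : Fin 3, ∀ j ∈ S, c j x = a ∨ c j x = b) (hodd : Odd S.card) :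
    S.card < 2 * (S.filter fun j => c j x = maj c S x).card := by
  obtain ⟨q, hq⟩ := exists_majority hbi hodd
  unfold maj
  split_ifs with h1 h2
  · exact h1
  · exact h2
  · have hq0 : q = 0 := by
      rcases fin3_cases q with h | h | h
      · exact h
      · subst h; exact absurd hq h1
      · subst h; exact absurd hq h2
    subst hq0
    exact hq

/-- Two strict majorities inside `S` share a member. -/
theorem card_inter_pos {S A B : Finset (Fin m)} (hA : A ⊆ S) (hB : B ⊆ S)
    (h2A : S.card < 2 * A.card) (h2B : S.card < 2 * B.card) : 0 < (A ∩ B).card := by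
  have h1 := card_union_add_card_inter A B
  have h2 : (A ∪ B).card ≤ S.card := card_le_card (union_subset hA hB)
  omega

/-- **Majority lemma.**  The majority colouring of an odd bivalent family of proper colourings of `E` is a proper
colouring of `E`. -/
theorem maj_not_mem_killSet {c : Fin m → Fin n → Fin 3} {S : Finset (Fin m)} {E : Finset (Sym2 (Fin n))}
    (hE : ∀ j ∈ S, c j ∉ killSet E) (hbi : Bivalent c S) (hodd : Odd S.card) : maj c S ∉ killSet E := by
  rintro ⟨e, he, hd, hm⟩
  revert he hd hm
  induction e using Sym2.ind with
  | h x y =>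
    intro he hd hm
    have hq : maj c S x = maj c S y := (map_mk_isDiag_iff _ x y).1 hm
    have hx := maj_majority (hbi x) hodd
    have hy := maj_majority (hbi y) hodd
    rw [hq] at hx
    obtain ⟨j, hj⟩ := card_pos.1 (card_inter_pos (filter_subset _ S) (filter_subset _ S) hx hy)
    rw [mem_inter, mem_filter, mem_filter] at hj
    exact hE j hj.1.1 ⟨s(x, y), he, hd, (map_mk_isDiag_iff _ x y).2 (hj.1.2.trans hj.2.2.symm)⟩

/-! ## §2  Sources: the apex of an odd sub-family and the regularity of everybody else -/

/-- The REGULARITY indicator over `ZMod 2`: `[c j (u w) = q] + [c j (v w) = q]` with `q = c w (u w)` the own colour of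
unit `w` on its pair.  It is `0` for `j = w` (both hold) and for an ESCAPE (neither holds), `1` for a regular `j`. -/
def phi (c : Fin m → Fin n → Fin 3) (u v : Fin m → Fin n) (w j : Fin m) : ZMod 2 :=
  (if c j (u w) = c w (u w) then 1 else 0) + (if c j (v w) = c w (u w) then 1 else 0)

/-- **Source lemma.**  In an odd bivalent sub-family `S` there is an APEX `w ∈ S`: its pair is monochromatic under its own
witness, and every other member of `S` is regular on that pair (no escapes inside `S`). -/
theorem exists_source {c : Fin m → Fin n → Fin 3} {S₀ S : Finset (Fin m)} {u v : Fin m → Fin n}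
    (hW : ∀ j ∈ S₀, c j ∉ killSet W) (hbi : Bivalent c S₀)
    (hD1 : ∀ c' : Fin n → Fin 3, c' ∉ killSet W → ∃ w, c' (u w) = c' (v w))
    (hpriv : ∀ w j, j ≠ w → c j (u w) ≠ c j (v w)) (hS : S ⊆ S₀) (hodd : Odd S.card) :
    ∃ w ∈ S, c w (u w) = c w (v w) ∧ ∀ j ∈ S, j ≠ w → phi c u v w j = 1 := by
  have hbiS : Bivalent c S := hbi.mono hS
  obtain ⟨w, hw⟩ := hD1 (maj c S) (maj_not_mem_killSet (fun j hj => hW j (hS hj)) hbiS hodd)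
  set q := maj c S (u w) with hq_def
  have hA := maj_majority (hbiS (u w)) hodd
  have hB := maj_majority (hbiS (v w)) hodd
  rw [← hw] at hB
  set A := S.filter fun j => c j (u w) = q with hA_def
  set B := S.filter fun j => c j (v w) = q with hB_def
  have hAB1 : ∀ j ∈ A, j ∈ B → j = w := by
    intro j hjA hjB
    by_contra hjw
    exact hpriv w j hjw ((mem_filter.1 hjA).2.trans (mem_filter.1 hjB).2.symm)
  have hu := card_union_add_card_inter A B
  have hUS : (A ∪ B).card ≤ S.card := card_le_card (union_subset (filter_subset _ _) (filter_subset _ _))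
  have hI1 : (A ∩ B).card ≤ 1 := card_le_one.2 (fun i hi j hj => by
    rw [mem_inter] at hi hj
    rw [hAB1 i hi.1 hi.2, hAB1 j hj.1 hj.2])
  have hIpos : 0 < (A ∩ B).card := by omega
  obtain ⟨i, hi⟩ := card_pos.1 hIpos
  have hiw : i = w := hAB1 i (mem_inter.1 hi).1 (mem_inter.1 hi).2
  have hwA : w ∈ A := by rw [← hiw]; exact (mem_inter.1 hi).1
  have hwB : w ∈ B := by rw [← hiw]; exact (mem_inter.1 hi).2
  have hwS : w ∈ S := (mem_filter.1 hwA).1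
  have hcu : c w (u w) = q := (mem_filter.1 hwA).2
  have hcv : c w (v w) = q := (mem_filter.1 hwB).2
  have hUeq : A ∪ B = S :=
    eq_of_subset_of_card_le (union_subset (filter_subset _ _) (filter_subset _ _)) (by omega)
  refine ⟨w, hwS, hcu.trans hcv.symm, fun j hj hjw => ?_⟩
  have hjU : j ∈ A ∪ B := by rw [hUeq]; exact hj
  have hnot : ¬ (j ∈ A ∧ j ∈ B) := fun h => hjw (hAB1 j h.1 h.2)
  unfold phi
  rw [hcu]
  rcases mem_union.1 hjU with hjA | hjB
  · have h1 : c j (u w) = q := (mem_filter.1 hjA).2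
    have h2 : c j (v w) ≠ q := fun h => hnot ⟨hjA, mem_filter.2 ⟨hj, h⟩⟩
    simp [h1, h2]
  · have h2 : c j (v w) = q := (mem_filter.1 hjB).2
    have h1 : c j (u w) ≠ q := fun h => hnot ⟨mem_filter.2 ⟨hj, h⟩, hjB⟩
    simp [h1, h2]

/-! ## §3  The source sequence and the affine rank bound -/

/-- **Source sequence.**  Every `S ⊆ S₀` contains a sequence `y₁, …, y_h` with `|S| ≤ 2h`, own pairs monochromatic, and the
unitriangular regularity pattern `phi (y k) (y l) = 1` for `k < l`. -/
theorem exists_chain {c : Fin m → Fin n → Fin 3} {S₀ : Finset (Fin m)} {u v : Fin m → Fin n}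
    (hW : ∀ j ∈ S₀, c j ∉ killSet W) (hbi : Bivalent c S₀)
    (hD1 : ∀ c' : Fin n → Fin 3, c' ∉ killSet W → ∃ w, c' (u w) = c' (v w))
    (hpriv : ∀ w j, j ≠ w → c j (u w) ≠ c j (v w)) :
    ∀ S, S ⊆ S₀ → ∃ (h : ℕ) (y : Fin h → Fin m), S.card ≤ 2 * h ∧ (∀ k, y k ∈ S) ∧
      (∀ k, c (y k) (u (y k)) = c (y k) (v (y k))) ∧ ∀ k l, k < l → phi c u v (y k) (y l) = 1 := by
  suffices H : ∀ N : ℕ, ∀ S, S ⊆ S₀ → S.card ≤ N → ∃ (h : ℕ) (y : Fin h → Fin m), S.card ≤ 2 * h ∧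
      (∀ k, y k ∈ S) ∧ (∀ k, c (y k) (u (y k)) = c (y k) (v (y k))) ∧
      ∀ k l, k < l → phi c u v (y k) (y l) = 1 from fun S hS => H S.card S hS le_rfl
  intro N
  induction N with
  | zero =>
    intro S hS hcard
    have hS0 : S = ∅ := card_eq_zero.1 (by omega)
    subst hS0
    exact ⟨0, Fin.elim0, by simp, fun k => k.elim0, fun k => k.elim0, fun k => k.elim0⟩
  | succ N ih =>
    intro S hS hcard
    rcases S.eq_empty_or_nonempty with rfl | hne
    · exact ⟨0, Fin.elim0, by simp, fun k => k.elim0, fun k => k.elim0, fun k => k.elim0⟩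
    by_cases hodd : Odd S.card
    · obtain ⟨w, hwS, hmono, hreg⟩ := exists_source hW hbi hD1 hpriv hS hodd
      obtain ⟨h, y, hc, hyS, hym, hyr⟩ := ih (S.erase w) ((erase_subset _ _).trans hS)
        (by rw [card_erase_of_mem hwS]; omega)
      refine ⟨h + 1, Matrix.vecCons w y, ?_, ?_, ?_, ?_⟩
      · rw [card_erase_of_mem hwS] at hc; omega
      · intro k
        refine Fin.cases ?_ (fun k' => ?_) k
        · simpa using hwS
        · simpa using mem_of_mem_erase (hyS k')
      · intro k
        refine Fin.cases ?_ (fun k' => ?_) k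
        · simpa using hmono
        · simpa using hym k'
      · intro k l
        refine Fin.cases ?_ (fun k' => ?_) k
        · refine Fin.cases ?_ (fun l' => ?_) l
          · intro h0; exact absurd h0 (lt_irrefl _)
          · intro _
            have hl' : y l' ∈ S.erase w := hyS l'
            simp only [Matrix.cons_val_zero, Matrix.cons_val_succ]
            exact hreg (y l') (mem_of_mem_erase hl') (ne_of_mem_erase hl')
        · refine Fin.cases ?_ (fun l' => ?_) l
          · intro h0; exact absurd (Fin.lt_def.1 h0) (by simp)
          · intro hkl
            simp only [Matrix.cons_val_succ]
            exact hyr k' l' (Fin.succ_lt_succ_iff.1 hkl)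
    · obtain ⟨w, hwS⟩ := hne
      obtain ⟨h, y, hc, hyS, hym, hyr⟩ := ih (S.erase w) ((erase_subset _ _).trans hS)
        (by rw [card_erase_of_mem hwS]; omega)
      refine ⟨h, y, ?_, fun k => mem_of_mem_erase (hyS k), hym, hyr⟩
      rw [card_erase_of_mem hwS] at hc
      have hpos : 0 < S.card := card_pos.2 ⟨w, hwS⟩
      rcases Nat.even_or_odd S.card with ⟨r, hr⟩ | ho
      · omega
      · exact absurd ho hodd

/-- **Triangular parity lemma.**  Vectors `x l : Fin n → ZMod 2` (`l < h`) and affine functionals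
`y ↦ α k * y (u k) + β k * y (v k) + κ k` evaluating to `1` strictly above the diagonal and to `0` on it force
`h ≤ n + 1` (the vectors `x l + x (h-1)`, `l < h - 1`, are linearly independent). -/
theorem triangular_parity_le {h n : ℕ} (x : Fin h → Fin n → ZMod 2) (u v : Fin h → Fin n)
    (α β κ : Fin h → ZMod 2)
    (hlt : ∀ k l, k < l → α k * x l (u k) + β k * x l (v k) + κ k = 1)
    (hdiag : ∀ k, α k * x k (u k) + β k * x k (v k) + κ k = 0) : h ≤ n + 1 := by
  have hzz : ∀ z : ZMod 2, z + z = 0 := by decide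
  cases h with
  | zero => omega
  | succ h' =>
    suffices hli : LinearIndependent (ZMod 2) (fun l : Fin h' => x l.castSucc + x (Fin.last h')) by
      have := hli.fintype_card_le_finrank
      simp only [Fintype.card_fin, Module.finrank_fintype_fun_eq_card] at this
      omega
    -- the functional `k` applied to the vector `l`
    have hval : ∀ k l : Fin h',
        α k.castSucc * (x l.castSucc (u k.castSucc) + x (Fin.last h') (u k.castSucc)) +
          β k.castSucc * (x l.castSucc (v k.castSucc) + x (Fin.last h') (v k.castSucc))
        = if l = k then 1 else if k < l then 0 else
            (α k.castSucc * x l.castSucc (u k.castSucc) + β k.castSucc * x l.castSucc (v k.castSucc)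
              + κ k.castSucc) + 1 := by
      intro k l
      have elast := hlt k.castSucc (Fin.last h') (Fin.castSucc_lt_last k)
      have hrw : α k.castSucc * (x l.castSucc (u k.castSucc) + x (Fin.last h') (u k.castSucc)) +
          β k.castSucc * (x l.castSucc (v k.castSucc) + x (Fin.last h') (v k.castSucc))
          = (α k.castSucc * x l.castSucc (u k.castSucc) + β k.castSucc * x l.castSucc (v k.castSucc)
              + κ k.castSucc)
            + (α k.castSucc * x (Fin.last h') (u k.castSucc) + β k.castSucc * x (Fin.last h') (v k.castSucc)
              + κ k.castSucc) - (κ k.castSucc + κ k.castSucc) := by ring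
      rw [hrw, elast, hzz, sub_zero]
      by_cases hlk : l = k
      · subst hlk
        rw [if_pos rfl, hdiag]
        decide
      · rw [if_neg hlk]
        by_cases hkl : k < l
        · rw [if_pos hkl, hlt k.castSucc l.castSucc (Fin.castSucc_lt_castSucc_iff.2 hkl)]
          decide
        · rw [if_neg hkl]
    rw [Fintype.linearIndependent_iff]
    intro g hg
    suffices H : ∀ N : ℕ, ∀ k : Fin h', (k : ℕ) < N → g k = 0 from fun k => H _ k (Nat.lt_succ_self _)
    intro N
    induction N with
    | zero => intro k hk; omega
    | succ N ih =>
      intro k hk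
      by_cases hkN : (k : ℕ) < N
      · exact ih k hkN
      have e1 := congrFun hg (u k.castSucc)
      have e2 := congrFun hg (v k.castSucc)
      simp only [Finset.sum_apply, Pi.smul_apply, Pi.add_apply, smul_eq_mul, Pi.zero_apply] at e1 e2
      have hsum : ∑ l : Fin h', g l *
          (α k.castSucc * (x l.castSucc (u k.castSucc) + x (Fin.last h') (u k.castSucc)) +
            β k.castSucc * (x l.castSucc (v k.castSucc) + x (Fin.last h') (v k.castSucc))) = 0 := by
        have hsplit : ∑ l : Fin h', g l *
            (α k.castSucc * (x l.castSucc (u k.castSucc) + x (Fin.last h') (u k.castSucc)) +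
              β k.castSucc * (x l.castSucc (v k.castSucc) + x (Fin.last h') (v k.castSucc)))
            = α k.castSucc * ∑ l : Fin h', g l * (x l.castSucc (u k.castSucc) + x (Fin.last h') (u k.castSucc))
              + β k.castSucc *
                ∑ l : Fin h', g l * (x l.castSucc (v k.castSucc) + x (Fin.last h') (v k.castSucc)) := by
          rw [mul_sum, mul_sum, ← sum_add_distrib]
          exact sum_congr rfl fun l _ => by ring
        rw [hsplit, e1, e2, mul_zero, mul_zero, add_zero]
      have hterm : ∀ l : Fin h', g l *
          (α k.castSucc * (x l.castSucc (u k.castSucc) + x (Fin.last h') (u k.castSucc)) +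
            β k.castSucc * (x l.castSucc (v k.castSucc) + x (Fin.last h') (v k.castSucc)))
          = if l = k then g k else 0 := by
        intro l
        rw [hval k l]
        by_cases hlk : l = k
        · subst hlk; simp
        · rw [if_neg hlk, if_neg hlk]
          by_cases hkl : k < l
          · rw [if_pos hkl, mul_zero]
          · rw [if_neg hkl]
            have hlk' : (l : ℕ) < N := by
              have hlt' : l < k := lt_of_le_of_ne (not_lt.1 hkl) hlk
              have := Fin.lt_def.1 hlt'
              omega
            rw [ih l hlk', zero_mul]
      rw [sum_congr rfl (fun l _ => hterm l)] at hsum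
      simpa [sum_ite_eq'] using hsum

/-- Coefficient table making colour indicators AFFINE in one bit: for `y ∈ {a, b}`,
`[y = s] = (coef a b s).1 * [y = a] + (coef a b s).2` over `ZMod 2` (`indicator_affine`). -/
def coef (a b s : Fin 3) : ZMod 2 × ZMod 2 :=
  if s = a then (1, 0) else if s = b then (1, 1) else (0, 0)

theorem indicator_affine : ∀ a b s y : Fin 3, (y = a ∨ y = b) →
    (if y = s then (1 : ZMod 2) else 0) = (coef a b s).1 * (if y = a then 1 else 0) + (coef a b s).2 := by
  decide

/-- **THE BIVALENCE WALL (colouring level).**  Colourings `c j` (`j ∈ S₀`) proper on `W`, bivalent on `S₀`, with private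
pairs (`c j` bichromatic on the pair of every unit `w ≠ j`), over a frame `W` with the D1 property in colouring form
(every proper colouring of `W` is monochromatic on some unit's pair): then `|S₀| ≤ 2n + 2`. -/
theorem card_le_of_bivalent {c : Fin m → Fin n → Fin 3} {S₀ : Finset (Fin m)} {u v : Fin m → Fin n}
    (hW : ∀ j ∈ S₀, c j ∉ killSet W) (hbi : Bivalent c S₀)
    (hD1 : ∀ c' : Fin n → Fin 3, c' ∉ killSet W → ∃ w, c' (u w) = c' (v w))
    (hpriv : ∀ w j, j ≠ w → c j (u w) ≠ c j (v w)) : S₀.card ≤ 2 * n + 2 := by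
  obtain ⟨h, y, hcard, hyS, hym, hyr⟩ := exists_chain hW hbi hD1 hpriv S₀ Subset.rfl
  choose a b hab using hbi
  -- bits and coefficients
  set X : Fin m → Fin n → ZMod 2 := fun j z => if c j z = a z then 1 else 0 with hX
  set s : Fin h → Fin 3 := fun k => c (y k) (u (y k)) with hs
  set α : Fin h → ZMod 2 := fun k => (coef (a (u (y k))) (b (u (y k))) (s k)).1 with hα
  set β : Fin h → ZMod 2 := fun k => (coef (a (v (y k))) (b (v (y k))) (s k)).1 with hβ
  set κ : Fin h → ZMod 2 := fun k =>
    (coef (a (u (y k))) (b (u (y k))) (s k)).2 + (coef (a (v (y k))) (b (v (y k))) (s k)).2 with hκ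
  have hphi : ∀ k l, phi c u v (y k) (y l) = α k * X (y l) (u (y k)) + β k * X (y l) (v (y k)) + κ k := by
    intro k l
    have e1 := indicator_affine (a (u (y k))) (b (u (y k))) (s k) (c (y l) (u (y k))) (hab _ _ (hyS l))
    have e2 := indicator_affine (a (v (y k))) (b (v (y k))) (s k) (c (y l) (v (y k))) (hab _ _ (hyS l))
    simp only [phi, hX, hα, hβ, hκ, hs] at e1 e2 ⊢
    rw [e1, e2]
    ring
  have hlt : ∀ k l, k < l → α k * X (y l) (u (y k)) + β k * X (y l) (v (y k)) + κ k = 1 := by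
    intro k l hkl
    rw [← hphi]
    exact hyr k l hkl
  have hdiag : ∀ k, α k * X (y k) (u (y k)) + β k * X (y k) (v (y k)) + κ k = 0 := by
    intro k
    rw [← hphi]
    have h2 : phi c u v (y k) (y k) = 1 + 1 := by simp [phi, hym k]
    rw [h2]
    decide
  have hle := triangular_parity_le (fun l => X (y l)) (fun k => u (y k)) (fun k => v (y k)) α β κ hlt hdiag
  omega

/-- **THE BIVALENCE WALL (unit-system level).**  In a D1 ∧ D2 unit system, every family of D2 witnesses that is bivalent on an
index set `S₀` has `|S₀| ≤ 2n + 2`. -/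
theorem card_le_of_bivalent_witnesses (hsys : IsUnitSystem n m W π) (c : Fin m → Fin n → Fin 3)
    (hc : ∀ i, c i ∉ killSet (gammaMinus W π i)) (S₀ : Finset (Fin m)) (hbi : Bivalent c S₀) :
    S₀.card ≤ 2 * n + 2 := by
  obtain ⟨u, v, huv⟩ := exists_pair_fun hsys
  exact card_le_of_bivalent (W := W) (u := u) (v := v)
    (fun j _ h => hc j (killSet_mono (subset_gammaMinus j) h)) hbi
    (fun c' hc' => exists_mono_unit hsys huv hc')
    (fun w j hjw => witness_bichromatic hsys hjw.symm (hc j) (huv w))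

/-! ## §4  Typed frames (2-list / bijunctive frames) are linear, hence never SPREAD -/

/-- A TYPED frame: a palette triangle `p 0, p 1, p 2` of `W` (distinct vertices, all three edges in `W`), and every vertex is
a palette vertex or `W`-adjacent to a (different) palette vertex.  Equivalently: the proper 3-colourings of `W` are the
solutions of a 2-LIST-colouring (bijunctive, 2-SAT) instance. -/
def Typed (W : Finset (Sym2 (Fin n))) (p : Fin 3 → Fin n) : Prop :=
  (∀ a b : Fin 3, a ≠ b → p a ≠ p b ∧ s(p a, p b) ∈ W) ∧
  ∀ x : Fin n, (∃ a, x = p a) ∨ ∃ a, x ≠ p a ∧ s(x, p a) ∈ W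

/-- Recolouring by a permutation of the colours does not change which edge sets are killed. -/
theorem killSet_perm_comp {S : Finset (Sym2 (Fin n))} (σ : Equiv.Perm (Fin 3)) {c : Fin n → Fin 3} :
    (σ ∘ c) ∈ killSet S ↔ c ∈ killSet S := by
  simp only [killSet, Set.mem_setOf_eq]
  refine exists_congr fun e => and_congr_right fun _ => and_congr_right fun _ => ?_
  induction e using Sym2.ind with
  | h x y =>
    rw [map_mk_isDiag_iff, map_mk_isDiag_iff]
    exact σ.injective.eq_iff

/-- A proper colouring of a typed frame can be normalised to give the palette vertex `p a` colour `a`. -/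
theorem exists_normalising_perm {p : Fin 3 → Fin n} (hT : Typed W p) {c : Fin n → Fin 3} (hc : c ∉ killSet W) :
    ∃ σ : Equiv.Perm (Fin 3), ∀ a, σ (c (p a)) = a := by
  have hinj : Function.Injective (c ∘ p) := by
    intro a b hab
    by_contra hne
    obtain ⟨hpab, hWab⟩ := hT.1 a b hne
    exact hc ⟨s(p a, p b), hWab, fun hd => hpab (Sym2.mk_isDiag_iff.1 hd), (map_mk_isDiag_iff c _ _).2 hab⟩
  have hbij : Function.Bijective (c ∘ p) := Finite.injective_iff_bijective.1 hinj
  exact ⟨(Equiv.ofBijective _ hbij).symm, fun a => (Equiv.ofBijective _ hbij).symm_apply_apply a⟩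

theorem fin3_ne_cases : ∀ a y : Fin 3, y ≠ a → y = a + 1 ∨ y = a + 2 := by decide

/-- Palette-normalised proper colourings of a typed frame form a bivalent family (on every index set). -/
theorem bivalent_of_typed {p : Fin 3 → Fin n} (hT : Typed W p) {c : Fin m → Fin n → Fin 3}
    (hcW : ∀ j, c j ∉ killSet W) (hnorm : ∀ j a, c j (p a) = a) (S : Finset (Fin m)) : Bivalent c S := by
  intro x
  rcases hT.2 x with ⟨a, rfl⟩ | ⟨a, hxa, hWa⟩
  · exact ⟨a, a, fun j _ => Or.inl (hnorm j a)⟩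
  · refine ⟨a + 1, a + 2, fun j _ => fin3_ne_cases a (c j x) fun h => ?_⟩
    exact hcW j ⟨s(x, p a), hWa, fun hd => hxa (Sym2.mk_isDiag_iff.1 hd),
      (map_mk_isDiag_iff (c j) _ _).2 (h.trans (hnorm j a).symm)⟩

/-- D2 witnesses of a typed frame can be chosen palette-normalised. -/
theorem exists_normalised_witnesses (hsys : IsUnitSystem n m W π) {p : Fin 3 → Fin n} (hT : Typed W p) :
    ∃ c : Fin m → Fin n → Fin 3, (∀ i, c i ∉ killSet (gammaMinus W π i)) ∧ ∀ j a, c j (p a) = a := by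
  obtain ⟨c, hc⟩ := exists_witnesses hsys
  have hcW : ∀ j, c j ∉ killSet W := fun j h => hc j (killSet_mono (subset_gammaMinus j) h)
  choose σ hσ using fun j => exists_normalising_perm hT (hcW j)
  refine ⟨fun j => σ j ∘ c j, fun i h => hc i ((killSet_perm_comp (σ i)).1 h), fun j a => ?_⟩
  exact hσ j a

/-- **TYPED FRAMES ARE LINEAR.**  A D1 ∧ D2 unit system over a typed frame has at most `2n + 2` units. -/
theorem units_le_of_typed (hsys : IsUnitSystem n m W π) {p : Fin 3 → Fin n} (hT : Typed W p) :
    m ≤ 2 * n + 2 := by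
  obtain ⟨c, hc, hnorm⟩ := exists_normalised_witnesses hsys hT
  have hcW : ∀ j, c j ∉ killSet W := fun j h => hc j (killSet_mono (subset_gammaMinus j) h)
  have hbi : Bivalent c univ := bivalent_of_typed hT hcW hnorm univ
  have := card_le_of_bivalent_witnesses hsys c hc univ hbi
  simpa using this

/-- The SPREAD clause of the engine hypothesis (verbatim `P4g5/P4g8.Spread`). -/
def Spread (ε T : ℝ) (π : Fin m → Finset (Sym2 (Fin n))) : Prop :=
  ∀ B : Finset (Fin n), (1 / 2 - ε) * (n : ℝ) ≤ B.card → (B.card : ℝ) ≤ (1 / 2 + ε) * n →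
    ∃ I : Finset (Fin m), T ≤ I.card ∧ ∀ i ∈ I, (∃ e ∈ π i, ∀ v ∈ e, v ∈ B) ∧ (∃ e ∈ π i, ∃ v ∈ e, v ∉ B)

/-- Trivial floor (verbatim g8): once the window contains a near-bisection (`2εn ≥ 1`), the demand is at most the number
of units. -/
theorem demand_le_units_of_spread {ε T : ℝ} (hεn : 1 ≤ 2 * ε * n) (h : Spread ε T π) : T ≤ m := by
  classical
  obtain ⟨B, -, hBcard⟩ := exists_subset_card_eq (s := (univ : Finset (Fin n))) (n := (n + 1) / 2)
    (by rw [card_univ, Fintype.card_fin]; omega)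
  have h1 : (n : ℝ) ≤ 2 * (B.card : ℝ) + 1 := by exact_mod_cast (by omega : n ≤ 2 * B.card + 1)
  have h2 : 2 * (B.card : ℝ) ≤ n + 1 := by exact_mod_cast (by omega : 2 * B.card ≤ n + 1)
  have hn : (0 : ℝ) ≤ n := Nat.cast_nonneg n
  obtain ⟨I, hT, -⟩ := h B (by nlinarith) (by nlinarith)
  refine hT.trans ?_
  exact_mod_cast (card_le_univ I).trans (by rw [Fintype.card_fin])

/-- **The engine cannot fire on a typed frame** (`n ≥ 64`): `m ≤ 2n + 2 < 3n ≤ (n/2)·log₂ n + C·n`. -/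
theorem not_spread_of_typed (hsys : IsUnitSystem n m W π) {p : Fin 3 → Fin n} (hT : Typed W p)
    {ε : ℝ} {C : ℕ} (hn : 64 ≤ n) (hεn : 1 ≤ 2 * ε * n) :
    ¬ Spread ε ((n : ℝ) / 2 * Real.logb 2 n + (C : ℝ) * n) π := by
  intro h
  have hm : (m : ℝ) ≤ 2 * n + 2 := by exact_mod_cast units_le_of_typed hsys hT
  have hT' := demand_le_units_of_spread hεn h
  have hn' : (64 : ℝ) ≤ n := by exact_mod_cast hn
  have hlog : (6 : ℝ) ≤ Real.logb 2 n := by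
    rw [Real.le_logb_iff_rpow_le (by norm_num) (by linarith)]
    have : (2 : ℝ) ^ (6 : ℝ) = 64 := by
      rw [show (6 : ℝ) = ((6 : ℕ) : ℝ) by norm_num, Real.rpow_natCast]
      norm_num
    rw [this]
    exact hn'
  have hC : (0 : ℝ) ≤ (C : ℝ) * n := by positivity
  have h3n : 3 * (n : ℝ) ≤ (n : ℝ) / 2 * Real.logb 2 n := by nlinarith
  linarith

/-! ## §5  The trivalent budget: units ≤ (2n + 2) × witness patterns on the untyped set -/

/-- TYPED OUTSIDE `U`: a palette triangle, and every vertex NOT in `U` is a palette vertex or `W`-adjacent to one.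
(`Typed W p ↔ TypedOutside W p ∅`.)  The vertices of `U` are the only candidates for trivalence. -/
def TypedOutside (W : Finset (Sym2 (Fin n))) (p : Fin 3 → Fin n) (U : Finset (Fin n)) : Prop :=
  (∀ a b : Fin 3, a ≠ b → p a ≠ p b ∧ s(p a, p b) ∈ W) ∧
  ∀ x : Fin n, x ∉ U → (∃ a, x = p a) ∨ ∃ a, x ≠ p a ∧ s(x, p a) ∈ W

theorem typed_iff_typedOutside_empty {p : Fin 3 → Fin n} : Typed W p ↔ TypedOutside W p ∅ := by
  simp [Typed, TypedOutside]

/-- The PATTERN of witness `j` on `U` (zero outside `U`). -/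
def pat (U : Finset (Fin n)) (c : Fin m → Fin n → Fin 3) (j : Fin m) : Fin n → Fin 3 :=
  fun x => if x ∈ U then c j x else 0

/-- A class of palette-normalised witnesses with ONE common pattern on `U` is bivalent when everything outside `U` is typed. -/
theorem bivalent_fiber {p : Fin 3 → Fin n} {U : Finset (Fin n)} (hT : TypedOutside W p U)
    {c : Fin m → Fin n → Fin 3} (hcW : ∀ j, c j ∉ killSet W) (hnorm : ∀ j a, c j (p a) = a)
    (κ : Fin n → Fin 3) : Bivalent c (univ.filter fun j => pat U c j = κ) := by
  intro x
  by_cases hxU : x ∈ U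
  · refine ⟨κ x, κ x, fun j hj => Or.inl ?_⟩
    have hpj : pat U c j = κ := (mem_filter.1 hj).2
    have := congrFun hpj x
    simpa [pat, hxU] using this
  · rcases hT.2 x hxU with ⟨a, rfl⟩ | ⟨a, hxa, hWa⟩
    · exact ⟨a, a, fun j _ => Or.inl (hnorm j a)⟩
    · refine ⟨a + 1, a + 2, fun j _ => fin3_ne_cases a (c j x) fun h => ?_⟩
      exact hcW j ⟨s(x, p a), hWa, fun hd => hxa (Sym2.mk_isDiag_iff.1 hd),
        (map_mk_isDiag_iff (c j) _ _).2 (h.trans (hnorm j a).symm)⟩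

/-- **TRIVALENT BUDGET.**  Over a frame typed outside `U`, for any palette-normalised family of D2 witnesses,
`m ≤ (2n + 2) · #{patterns of the witnesses on U}`: superlinearly many units need the witnesses to realise
`≥ m / (2n + 2)` distinct colourings of the untyped set `U` (in particular `U ≠ ∅`, and `m ≤ (2n+2) · 3^|U|`). -/
theorem units_le_patterns (hsys : IsUnitSystem n m W π) {p : Fin 3 → Fin n} {U : Finset (Fin n)}
    (hT : TypedOutside W p U) (c : Fin m → Fin n → Fin 3) (hc : ∀ i, c i ∉ killSet (gammaMinus W π i))
    (hnorm : ∀ j a, c j (p a) = a) :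
    m ≤ (2 * n + 2) * (univ.image (pat U c)).card := by
  have hcW : ∀ j, c j ∉ killSet W := fun j h => hc j (killSet_mono (subset_gammaMinus j) h)
  have hfib : ∀ κ ∈ univ.image (pat U c), (univ.filter fun j => pat U c j = κ).card ≤ 2 * n + 2 :=
    fun κ _ => card_le_of_bivalent_witnesses hsys c hc _ (bivalent_fiber hT hcW hnorm κ)
  have hsum := card_eq_sum_card_fiberwise (s := (univ : Finset (Fin m))) (t := univ.image (pat U c))
    (f := pat U c) (fun j hj => mem_image_of_mem _ hj)
  have hle := sum_le_card_nsmul (univ.image (pat U c)) (fun κ => (univ.filter fun j => pat U c j = κ).card)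
    (2 * n + 2) hfib
  rw [card_univ, Fintype.card_fin] at hsum
  rw [hsum, smul_eq_mul] at *
  linarith [hle]

/-! ## §6  Assumption-free form: RAINBOW vertices and the pattern budget of an arbitrary witness family -/

/-- The RAINBOW (trivalent) vertices of a witness family: all three colours occur there among the `c j`. -/
def rainbow (c : Fin m → Fin n → Fin 3) : Finset (Fin n) :=
  univ.filter fun x => ∀ q : Fin 3, ∃ j, c j x = q

/-- Off the rainbow set any family is bivalent. -/
theorem bivalent_at_of_not_rainbow {c : Fin m → Fin n → Fin 3} {x : Fin n} (hx : x ∉ rainbow c)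
    (S : Finset (Fin m)) : ∃ a b : Fin 3, ∀ j ∈ S, c j x = a ∨ c j x = b := by
  simp only [rainbow, mem_filter, mem_univ, true_and, not_forall, not_exists] at hx
  obtain ⟨q, hq⟩ := hx
  exact ⟨q + 1, q + 2, fun j _ => fin3_ne_cases q (c j x) (hq j)⟩

/-- **SUPERLINEAR ⟹ RAINBOW.**  If `m > 2n + 2`, EVERY family of D2 witnesses has a rainbow vertex: a vertex receiving all
three colours from the witnesses (the escaping hypothesis of the wall, as a theorem). -/
theorem rainbow_nonempty (hsys : IsUnitSystem n m W π) (c : Fin m → Fin n → Fin 3)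
    (hc : ∀ i, c i ∉ killSet (gammaMinus W π i)) (hm : 2 * n + 2 < m) : (rainbow c).Nonempty := by
  by_contra h0
  rw [not_nonempty_iff_eq_empty] at h0
  have hbi : Bivalent c univ := fun x =>
    bivalent_at_of_not_rainbow (by rw [h0]; exact notMem_empty x) univ
  have := card_le_of_bivalent_witnesses hsys c hc univ hbi
  rw [card_univ, Fintype.card_fin] at this
  omega

/-- A class of witnesses with one common pattern on the rainbow set is bivalent. -/
theorem bivalent_rainbow_fiber (c : Fin m → Fin n → Fin 3) (κ : Fin n → Fin 3) :
    Bivalent c (univ.filter fun j => pat (rainbow c) c j = κ) := by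
  intro x
  by_cases hx : x ∈ rainbow c
  · refine ⟨κ x, κ x, fun j hj => Or.inl ?_⟩
    have hpj : pat (rainbow c) c j = κ := (mem_filter.1 hj).2
    have := congrFun hpj x
    simpa [pat, hx] using this
  · exact bivalent_at_of_not_rainbow hx _

/-- **RAINBOW PATTERN BUDGET (no typedness assumed).**  For every D1 ∧ D2 unit system and every family of D2 witnesses,
`m ≤ (2n + 2) · #{patterns of the witnesses on their own rainbow set}`: `m` superlinear forces the witnesses to realise
`≥ m / (2n + 2)` distinct colourings of the rainbow set, in particular `|rainbow c| ≥ log₃ (m / (2n + 2))`. -/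
theorem units_le_rainbow_patterns (hsys : IsUnitSystem n m W π) (c : Fin m → Fin n → Fin 3)
    (hc : ∀ i, c i ∉ killSet (gammaMinus W π i)) :
    m ≤ (2 * n + 2) * (univ.image (pat (rainbow c) c)).card := by
  have hfib : ∀ κ ∈ univ.image (pat (rainbow c) c),
      (univ.filter fun j => pat (rainbow c) c j = κ).card ≤ 2 * n + 2 :=
    fun κ _ => card_le_of_bivalent_witnesses hsys c hc _ (bivalent_rainbow_fiber c κ)
  have hsum := card_eq_sum_card_fiberwise (s := (univ : Finset (Fin m))) (t := univ.image (pat (rainbow c) c))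
    (f := pat (rainbow c) c) (fun j hj => mem_image_of_mem _ hj)
  have hle := sum_le_card_nsmul (univ.image (pat (rainbow c) c))
    (fun κ => (univ.filter fun j => pat (rainbow c) c j = κ).card) (2 * n + 2) hfib
  rw [card_univ, Fintype.card_fin] at hsum
  rw [hsum, smul_eq_mul] at *
  linarith [hle]

/-- Patterns on a set `U` number at most `3 ^ |U|`. -/
theorem card_patterns_le (U : Finset (Fin n)) (c : Fin m → Fin n → Fin 3) :
    (univ.image (pat U c)).card ≤ 3 ^ U.card := by
  classical
  have hsub : univ.image (pat U c) ⊆ Fintype.piFinset fun x => if x ∈ U then (univ : Finset (Fin 3)) else {0} := by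
    intro κ hκ
    obtain ⟨j, -, rfl⟩ := mem_image.1 hκ
    refine Fintype.mem_piFinset.2 fun x => ?_
    by_cases hx : x ∈ U <;> simp [pat, hx]
  refine (card_le_card hsub).trans ?_
  rw [Fintype.card_piFinset]
  have : ∏ x : Fin n, (if x ∈ U then (univ : Finset (Fin 3)) else {0}).card
      = ∏ x : Fin n, (if x ∈ U then 3 else 1) := by
    refine prod_congr rfl fun x _ => ?_
    by_cases hx : x ∈ U <;> simp [hx]
  rw [this, prod_ite, prod_const, prod_const, one_pow, mul_one]
  have hU : (univ.filter fun x => x ∈ U) = U := by ext x; simp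
  rw [hU]

/-- Corollary: `m ≤ (2n + 2) · 3 ^ |rainbow c|` for every witness family `c`. -/
theorem units_le_pow_rainbow (hsys : IsUnitSystem n m W π) (c : Fin m → Fin n → Fin 3)
    (hc : ∀ i, c i ∉ killSet (gammaMinus W π i)) : m ≤ (2 * n + 2) * 3 ^ (rainbow c).card :=
  (units_le_rainbow_patterns hsys c hc).trans (Nat.mul_le_mul_left _ (card_patterns_le _ c))

/-! ## §7  Subsumption: swap (Kempe-star) families are bivalent -/

/-- A family of SWAPS of one base colouring `c₀` on one colour pair `{a, b}` (arbitrary swap sets `K j`, no Kempe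
structure needed) is bivalent: at `x` only `c₀ x` and `swap a b (c₀ x)` occur.  Hence `card_le_of_bivalent_witnesses`
contains the Kempe-star wall of `UnitCriticality.lean` §2 (there: `m ≤ n + 1` per colour pair; here `2n + 2`, but for
arbitrary bivalent families). -/
theorem bivalent_of_swaps (c₀ : Fin n → Fin 3) (a b : Fin 3) (K : Fin m → Finset (Fin n))
    (c : Fin m → Fin n → Fin 3) (hK : ∀ j x, c j x = if x ∈ K j then Equiv.swap a b (c₀ x) else c₀ x)
    (S : Finset (Fin m)) : Bivalent c S := by
  intro x
  refine ⟨Equiv.swap a b (c₀ x), c₀ x, fun j _ => ?_⟩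
  rw [hK j x]
  split_ifs
  · exact Or.inl rfl
  · exact Or.inr rfl

/-- Swap-witness systems are linear (cf. `P4g8.units_le_of_kempe_star_witnesses`). -/
theorem units_le_of_swap_witnesses (hsys : IsUnitSystem n m W π) (c₀ : Fin n → Fin 3) (a b : Fin 3)
    (K : Fin m → Finset (Fin n)) (c : Fin m → Fin n → Fin 3)
    (hK : ∀ j x, c j x = if x ∈ K j then Equiv.swap a b (c₀ x) else c₀ x)
    (hc : ∀ i, c i ∉ killSet (gammaMinus W π i)) : m ≤ 2 * n + 2 := by
  have := card_le_of_bivalent_witnesses hsys c hc univ (bivalent_of_swaps c₀ a b K c hK univ)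
  simpa using this

end Summit.PneNP.PneNP.Cruxes.FoolingMeasure.P4g9
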